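import Summits.CriticalPhenomena.PercolationContinuityZ3.Theorems.FK.HammingDistanceBlocks
import Summits.CriticalPhenomena.PercolationContinuityZ3.Theorems.FK.SphereArmEvents
import Summits.CriticalPhenomena.PercolationContinuityZ3.Theorems.FK.SteepnessAmplification
import HarnessLib

/-!
# Polynomial decay of the radius with an exponent above `d - 1` implies stretched-exponential decay at every
# lower density (Grimmett 2006, Lemma (5.71), in hypothesis form; the first stage of Thm. (5.60))

Claimed R42 (8)(c) in the cell INBOX at 2026-08-27T12:45:21Z by fkp-10a gen 349 (NEW CLAIM #2 of the gen), addressed to coordinator fk-4 g257 (seated 11:08Z 2026-08-27; R135 l.8027); lineage row FO-10a-g349n (self-suggested), package g349-nearexp, label NX-C.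
Support file of the `fk-continuity` cell (lineage fkp-10a, `--supports stmt-CriticalPhenomena-4575`); builds on
p205010 (kernel theorem, internal audit signed; external expert review pending).  No definitions, no named facts,
no sorries; standard axioms.  UNCONDITIONAL structure of the random-cluster model on `ℤ^d` (`q ≥ 1`, `d ≥ 1`).

Grimmett 2006, §5.5, **Lemma (5.71)**: for `q ≥ 1` and `0 < p < p̃_c(q)` there are `c > 0`, `Δ ∈ (0,1)` with
`φ⁰_{p,q}(A_n) ≤ exp(-c n^Δ)`, `A_n = {0 ↔ ∂Λ_n}`; proof (5.73)–(5.81): (5.74) improves the polynomial decay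
`n^{1-d}` to `n^{1-d-Δ₂}`, and then the ANNULUS ITERATION — `K ≍ n^{1-β}` disjoint shells of width `m ≍ n^β`, each
crossed by every path from `0` to `∂Λ_n`, each crossing having probability `≤ ρ n^{d-1} φ(A_m) ≤ ½` ((5.76)–(5.78)),
so that `φ_s(H_n) ≥ K/2` ((5.79)) and (5.68) gives `φ_r(A_n) ≤ exp(-c n^{Δ₃})` ((5.80)–(5.81)).  Here it is proved,
for EVERY box limit `φ^b_{p,q}` (either `b`), in hypothesis form with `p̃_c` replaced by its defining property:
**if `φ^b_{s,q}(0 ↔ ∂Λ_m) ≤ c₂ m^{-α}` for all `m ≥ 1` with `α > d - 1`, then for every `r < s`,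
`φ^b_{r,q}(0 ↔ ∂Λ_n) ≤ exp(-((s-r)/10) · n^{1-β})` for all large `n`, `β = ((d-1)/α + 1)/2 ∈ (0,1)`**
(`rcLimit_real_siteToBoundary_le_exp_neg_rpow`); combined with `SteepnessAmplification.lean`'s (5.73) ⇒ (5.74),
decay `c₁ n^{-(d-1)}` at some `t` gives stretched-exponential decay at every `r < t`
(`rcLimit_real_siteToBoundary_le_exp_neg_rpow_of_polynomial_decay` — Lemma (5.71) with the hypothesis
"`L(t,q) < ∞`" spelled out).  Crossings of annuli are replaced by the sphere arm events of `SphereArmEvents.lean`;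
the counting step is `HammingDistanceBlocks.lean`; the full Thm. (5.60) needs in addition the time constants
(5.61)–(5.66), not claimed.

## Contents (namespace `Summit.CriticalPhenomena.PercolationContinuityZ3.Theorems.FK`)

* arithmetic of the scales: `sphere_radius_lt`, `disjoint_shellPairs_of_ne`;
* **`rcLimit_real_siteToBoundary_le_exp_neg_rpow`** (exponent `α > d - 1` at `s` ⇒ `exp(-c n^{1-β})` at `r < s`);
* **`rcLimit_real_siteToBoundary_le_exp_neg_rpow_of_polynomial_decay`** (Lemma (5.71) in hypothesis form:
  `c₁ n^{-(d-1)}` at `t` ⇒ stretched-exponential at every `r < t`).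

## References

* G. Grimmett, *The Random-Cluster Model*, Springer 2006: §5.5 Lemma (5.71) and its proof (5.73)–(5.81),
  pp. 115–116; (5.68), (5.76). [Grimmett2006]
* G. R. Grimmett, M. S. T. Piza, Comm. Math. Phys. 189 (1997) 465–480. [GrimmettPiza1997]
-/

noncomputable section

open scoped Classical
open MeasureTheory Finset Filter
open scoped Topology

namespace Summit.CriticalPhenomena.PercolationContinuityZ3.Theorems

namespace FK

open Literature.Probability.LatticeModels Literature.Probability.Percolation
  Literature.Probability.Percolation.Steepness Literature.Probability.Percolation.DCT16

variable {d : ℕ}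

/-! ### Arithmetic of the scales -/

/-- The spheres fit inside `Λ_n`: with `K = (n - m - 1)/(2m+1)` and `i < K`, the radius `a_i = (2m+1)(i+1)`
satisfies `a_i + m < n`. [cite: Grimmett2006, proof of Lemma (5.71), (5.75) (R_i = im, K = ⌊n/m⌋)] -/
theorem sphere_radius_lt {n m K i : ℕ} (hK : K = (n - m - 1) / (2 * m + 1)) (hi : i < K) :
    (2 * m + 1) * (i + 1) + m < n := by
  have h1 : (2 * m + 1) * (i + 1) ≤ (2 * m + 1) * K := Nat.mul_le_mul_left _ hi
  have h2 : (2 * m + 1) * K ≤ n - m - 1 := by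
    rw [hK, mul_comm]; exact Nat.div_mul_le_self _ _
  have h3 : i + 1 ≤ (2 * m + 1) * (i + 1) := Nat.le_mul_of_pos_left _ (by omega)
  omega

/-- Distinct spheres `a_i = (2m+1)(i+1)` have disjoint shells of half-width `m`. [cite: Grimmett2006, proof of Lemma (5.71), (5.75)] -/
theorem disjoint_shellPairs_of_ne {m i j : ℕ} (hij : i ≠ j) :
    Disjoint {e : Sym2 (Site d) | ∀ v ∈ e, (2 * m + 1) * (i + 1) ≤ siteRad v + m ∧ siteRad v ≤ (2 * m + 1) * (i + 1) + m}
      {e : Sym2 (Site d) | ∀ v ∈ e, (2 * m + 1) * (j + 1) ≤ siteRad v + m ∧ siteRad v ≤ (2 * m + 1) * (j + 1) + m} := by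
  rcases lt_or_gt_of_ne hij with h | h
  · refine disjoint_shellPairs ?_
    have : (2 * m + 1) * (i + 1) + (2 * m + 1) ≤ (2 * m + 1) * (j + 1) := by
      rw [← Nat.mul_succ]; exact Nat.mul_le_mul_left _ (by omega)
    omega
  · refine (disjoint_shellPairs ?_).symm
    have : (2 * m + 1) * (j + 1) + (2 * m + 1) ≤ (2 * m + 1) * (i + 1) := by
      rw [← Nat.mul_succ]; exact Nat.mul_le_mul_left _ (by omega)
    omega

/-! ### Lemma (5.71), hypothesis form -/

set_option maxHeartbeats 400000 in
/-- **Polynomial decay with an exponent above `d - 1` ⇒ stretched-exponential decay at every lower density**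
(Grimmett 2006, Lemma (5.71), annulus iteration (5.75)–(5.81)).  Let `d ≥ 1`, `q ≥ 1`, `b` either boundary
condition, `0 < r < s < 1`.  If `φ^b_{s,q}(0 ↔ ∂Λ_m) ≤ c₂ · m^{-α}` for all `m ≥ 1` with `c₂ > 0` and `α > d - 1`, then
with `β = ((d-1)/α + 1)/2` there is `N` such that `φ^b_{r,q}(0 ↔ ∂Λ_n) ≤ exp(-((s-r)/10) · n^{1-β})` for all `n ≥ N`.
[cite: Grimmett2006, Lemma (5.71), proof (5.75)–(5.81) pp. 115–116] -/
theorem rcLimit_real_siteToBoundary_le_exp_neg_rpow (hd : 0 < d) (b : Bool) {q : ℝ} (hq : 1 ≤ q) {r s : ℝ}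
    (hr : 0 < r) (hrs : r < s) (hs : s < 1) {c₂ α : ℝ} (hc₂ : 0 < c₂) (hα : (d : ℝ) - 1 < α)
    (hdecay : ∀ m : ℕ, 1 ≤ m → (rcLimit d b s q).real (siteToBoundary d m) ≤ c₂ * (m : ℝ) ^ (-α)) :
    ∃ N : ℕ, ∀ n : ℕ, N ≤ n →
      (rcLimit d b r q).real (siteToBoundary d n) ≤
        Real.exp (-((s - r) / 10) * (n : ℝ) ^ (1 - (((d : ℝ) - 1) / α + 1) / 2)) := by
  -- the exponents
  set β : ℝ := (((d : ℝ) - 1) / α + 1) / 2 with hβ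
  have hd1 : (0 : ℝ) ≤ (d : ℝ) - 1 := by
    have : (1 : ℝ) ≤ d := by exact_mod_cast hd
    linarith
  have hα0 : 0 < α := lt_of_le_of_lt hd1 hα
  have hquot : ((d : ℝ) - 1) / α < 1 := (div_lt_one hα0).2 hα
  have hquot0 : 0 ≤ ((d : ℝ) - 1) / α := div_nonneg hd1 hα0.le
  have hβ1 : β < 1 := by rw [hβ]; linarith
  have hβ0 : 0 < β := by rw [hβ]; linarith
  have hγ : 0 < α * β - ((d : ℝ) - 1) := by
    have : ((d : ℝ) - 1) / α < β := by rw [hβ]; linarith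
    have := (div_lt_iff₀ hα0).1 this
    linarith
  set γ : ℝ := α * β - ((d : ℝ) - 1) with hγdef
  -- the measures
  have hrI : r ∈ Set.Icc (0 : ℝ) 1 := ⟨hr.le, (hrs.trans hs).le⟩
  have hsI : s ∈ Set.Icc (0 : ℝ) 1 := ⟨(hr.trans hrs).le, hs.le⟩
  have hPr := isBoxLimit_rcLimit (d := d) b hrI hq
  have hPs := isBoxLimit_rcLimit (d := d) b hsI hq
  haveI := hPs.isProbabilityMeasure
  haveI := hPr.isProbabilityMeasure
  set k₀ : Fin d := ⟨0, hd⟩ with hk₀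
  -- THRESHOLD 1: `2d(2n+1)^{d-1} c₂ (n^β)^{-α} ≤ 1/2` eventually (it is `≤ C n^{-γ} → 0`)
  have hev1 : ∀ᶠ n : ℕ in atTop,
      2 * (d : ℝ) * (2 * n + 1) ^ (d - 1) * (c₂ * ((n : ℝ) ^ β) ^ (-α)) ≤ 1 / 2 := by
    -- compare with `C n^{-γ}`, `C = 2 d 3^{d-1} c₂`
    have hlim : Tendsto (fun n : ℕ => 2 * (d : ℝ) * (3 : ℝ) ^ (d - 1) * c₂ * (n : ℝ) ^ (-γ)) atTop (𝓝 0) := by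
      have h := (tendsto_rpow_neg_atTop hγ).comp tendsto_natCast_atTop_atTop
      simpa using h.const_mul (2 * (d : ℝ) * (3 : ℝ) ^ (d - 1) * c₂)
    have hev := hlim.eventually (Iic_mem_nhds (show (0 : ℝ) < 1 / 2 by norm_num))
    filter_upwards [hev, eventually_ge_atTop 1] with n hn hn1
    have hn0 : (0 : ℝ) < n := by exact_mod_cast hn1
    refine le_trans ?_ hn
    -- `(2n+1)^{d-1} ≤ 3^{d-1} n^{d-1}` and `(n^β)^{-α} = n^{-αβ} = n^{-γ} · n^{-(d-1)}`
    have h1 : (2 * (n : ℝ) + 1) ^ (d - 1) ≤ (3 : ℝ) ^ (d - 1) * (n : ℝ) ^ ((d : ℝ) - 1) := by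
      have h1n : (1 : ℝ) ≤ n := by exact_mod_cast hn1
      have : (2 * (n : ℝ) + 1) ^ (d - 1) ≤ (3 * (n : ℝ)) ^ (d - 1) :=
        pow_le_pow_left₀ (by positivity) (by linarith) _
      refine this.trans (le_of_eq ?_)
      rw [mul_pow, ← Real.rpow_natCast (n : ℝ) (d - 1), Nat.cast_sub hd, Nat.cast_one]
    have h2 : ((n : ℝ) ^ β) ^ (-α) = (n : ℝ) ^ (-γ) * ((n : ℝ) ^ ((d : ℝ) - 1))⁻¹ := by
      rw [← Real.rpow_mul hn0.le, ← Real.rpow_neg hn0.le, ← Real.rpow_add hn0, hγdef]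
      congr 1; ring
    rw [h2]
    have hpos : 0 < (n : ℝ) ^ ((d : ℝ) - 1) := Real.rpow_pos_of_pos hn0 _
    calc 2 * (d : ℝ) * (2 * n + 1) ^ (d - 1) * (c₂ * ((n : ℝ) ^ (-γ) * ((n : ℝ) ^ ((d : ℝ) - 1))⁻¹))
        ≤ 2 * (d : ℝ) * ((3 : ℝ) ^ (d - 1) * (n : ℝ) ^ ((d : ℝ) - 1)) *
            (c₂ * ((n : ℝ) ^ (-γ) * ((n : ℝ) ^ ((d : ℝ) - 1))⁻¹)) := by
          gcongr
      _ = 2 * (d : ℝ) * (3 : ℝ) ^ (d - 1) * c₂ * (n : ℝ) ^ (-γ) := by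
          field_simp
  -- THRESHOLD 2: `n^β + 2 ≤ n/2` eventually, and `20 ≤ n^{1-β}` eventually
  have hev2 : ∀ᶠ n : ℕ in atTop, (n : ℝ) ^ β + 2 ≤ n / 2 := by
    have hlim : Tendsto (fun n : ℕ => (n : ℝ) ^ (β - 1)) atTop (𝓝 0) := by
      have h := (tendsto_rpow_neg_atTop (show 0 < 1 - β by linarith)).comp tendsto_natCast_atTop_atTop
      refine h.congr fun n => ?_
      simp only [Function.comp, neg_sub]
    have hev := hlim.eventually (Iic_mem_nhds (show (0 : ℝ) < 1 / 4 by norm_num))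
    filter_upwards [hev, eventually_ge_atTop 8] with n hn hn8
    have hn0 : (0 : ℝ) < n := by exact_mod_cast (show 0 < n by omega)
    have hn8' : (8 : ℝ) ≤ n := by exact_mod_cast hn8
    have h1 : (n : ℝ) ^ β = (n : ℝ) ^ (β - 1) * n := by
      rw [Real.rpow_sub_one hn0.ne', div_mul_cancel₀ _ hn0.ne']
    have h2 : (n : ℝ) ^ β ≤ n / 4 := by
      rw [h1]
      have := mul_le_mul_of_nonneg_right hn hn0.le
      linarith
    linarith
  have hev3 : ∀ᶠ n : ℕ in atTop, (20 : ℝ) ≤ (n : ℝ) ^ (1 - β) := by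
    have h := (tendsto_rpow_atTop (show 0 < 1 - β by linarith)).comp tendsto_natCast_atTop_atTop
    exact h.eventually_ge_atTop 20
  -- collect
  obtain ⟨N, hN⟩ := eventually_atTop.1 ((hev1.and hev2).and (hev3.and (eventually_ge_atTop 1)))
  refine ⟨N, fun n hn => ?_⟩
  obtain ⟨⟨h1n, h2n⟩, h3n, hn1⟩ := hN n hn
  have hn0 : (0 : ℝ) < n := by exact_mod_cast hn1
  have hnβ1 : (1 : ℝ) ≤ (n : ℝ) ^ β := Real.one_le_rpow (by exact_mod_cast hn1) hβ0.le
  -- the scales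
  set m : ℕ := ⌊(n : ℝ) ^ β⌋₊ + 1 with hm
  have hm1 : 1 ≤ m := by omega
  have hmlow : (n : ℝ) ^ β ≤ m := by
    rw [hm, Nat.cast_add, Nat.cast_one]; exact (Nat.lt_floor_add_one _).le
  have hmup : (m : ℝ) ≤ (n : ℝ) ^ β + 1 := by
    rw [hm, Nat.cast_add, Nat.cast_one]
    linarith [Nat.floor_le (Real.rpow_nonneg hn0.le β)]
  have hm0 : (0 : ℝ) < m := by exact_mod_cast hm1
  set K : ℕ := (n - m - 1) / (2 * m + 1) with hK
  -- `m + 1 ≤ n` (so that the natural subtraction is honest) and `K ≥ n^{1-β}/20`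
  have hmn : m + 1 ≤ n := by
    have : (m : ℝ) + 1 ≤ n := by linarith
    exact_mod_cast this
  have hKge : (n : ℝ) ^ (1 - β) / 20 ≤ K := by
    have h1 : ((n - m - 1 : ℕ) : ℝ) = (n : ℝ) - m - 1 := by
      rw [Nat.sub_sub, Nat.cast_sub (by omega), Nat.cast_add, Nat.cast_one]; ring
    have h2 : ((n - m - 1 : ℕ) : ℝ) / ((2 * m + 1 : ℕ) : ℝ) - 1 ≤ K := by
      -- natural-number division loses less than one (cf. `sub_one_le_cast_div` in the Literature)
      have h21 : n - m - 1 < (K + 1) * (2 * m + 1) :=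
        Nat.lt_mul_of_div_lt (by rw [hK]; exact Nat.lt_succ_self _) (by omega)
      have h22 : ((n - m - 1 : ℕ) : ℝ) < ((K : ℝ) + 1) * ((2 * m + 1 : ℕ) : ℝ) := by exact_mod_cast h21
      have h23 : (0 : ℝ) < ((2 * m + 1 : ℕ) : ℝ) := by positivity
      rw [sub_le_iff_le_add, div_le_iff₀ h23]
      linarith
    rw [h1] at h2
    have h3 : ((2 * m + 1 : ℕ) : ℝ) ≤ 5 * (n : ℝ) ^ β := by push_cast; linarith
    have h4 : (n : ℝ) / 2 ≤ (n : ℝ) - m - 1 := by linarith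
    have h5 : (n : ℝ) ^ (1 - β) / 10 ≤ ((n : ℝ) - m - 1) / ((2 * m + 1 : ℕ) : ℝ) := by
      have hpos : (0 : ℝ) < ((2 * m + 1 : ℕ) : ℝ) := by positivity
      rw [div_le_div_iff₀ (by norm_num) hpos, Real.rpow_sub hn0, Real.rpow_one]
      have := mul_le_mul h4 (le_refl (10 : ℝ)) (by norm_num) (by linarith)
      calc (n : ℝ) / (n : ℝ) ^ β * ((2 * m + 1 : ℕ) : ℝ) ≤ (n : ℝ) / (n : ℝ) ^ β * (5 * (n : ℝ) ^ β) :=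
            mul_le_mul_of_nonneg_left h3 (by positivity)
        _ = 5 * n := by field_simp
        _ ≤ ((n : ℝ) - m - 1) * 10 := by linarith
    linarith
  -- the events: lattice readings of `A_n` and of the sphere arms at radii `a_i = (2m+1)(i+1)`, `i < K`
  set E : Set (Sym2 (Site d)) := (zdGraph d).edgeSet with hE
  set A : Set (BondConfig (Site d)) := (fun ω : BondConfig (Site d) => ω ∩ E) ⁻¹' siteToBoundary d n with hA
  set L : ℕ → Set (BondConfig (Site d)) := fun i => (fun ω : BondConfig (Site d) => ω ∩ E) ⁻¹'
    {ω | ∃ z ∈ innerBoundary (zdGraph d) (box d ((2 * m + 1) * (i + 1))), ω ∈ armEvent z m} with hL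
  set Sh : ℕ → Set (Sym2 (Site d)) := fun i =>
    {e | ∀ v ∈ e, (2 * m + 1) * (i + 1) ≤ siteRad v + m ∧ siteRad v ≤ (2 * m + 1) * (i + 1) + m} with hSh
  have hAF : DeterminedBy A (↑(edgesIn (zdGraph d) (box d n)) : Set (Sym2 (Site d))) :=
    determinedBy_preimage_inter_edgeSet (DCT16.determinedBy_siteToBoundary d n)
  have hFE : (↑(edgesIn (zdGraph d) (box d n)) : Set (Sym2 (Site d))) ⊆ (zdGraph d).edgeSet := fun e he =>
    (mem_edgesIn_iff.1 (Finset.mem_coe.1 he)).1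
  have hAU : IsUpperSet A := fun ω ω' hle hω =>
    DCT16.isUpperSet_siteToBoundary d n (Set.inter_subset_inter_left _ hle) hω
  have hreal : ∀ {p : ℝ} (hp : p ∈ Set.Icc (0 : ℝ) 1) (X : Set (BondConfig (Site d))),
      (rcLimit d b p q).real ((fun ω : BondConfig (Site d) => ω ∩ E) ⁻¹' X) = (rcLimit d b p q).real X :=
    fun hp X => (isBoxLimit_rcLimit (d := d) b hp hq).real_preimage_inter_edgeSet_eq hp hq X
  have hAne : A.Nonempty := by
    refine nonempty_of_measureReal_ne_zero (μ := rcLimit d b s q) ?_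
    rw [hA, hreal hsI]
    exact (rcLimit_real_siteToBoundary_pos b ⟨hr.trans hrs, hs.le⟩ hq k₀ n).ne'
  have hAL : ∀ i ∈ Finset.range K, A ⊆ L i := fun i hi =>
    preimage_inter_edgeSet_siteToBoundary_subset hd (sphere_radius_lt hK (Finset.mem_range.1 hi))
  have hLE : ∀ i ∈ Finset.range K, DeterminedBy (L i) (Sh i) := fun i _ =>
    determinedBy_preimage_inter_edgeSet_of (determinedBy_sphereArm _ _)
  have hdisj : (↑(Finset.range K) : Set ℕ).PairwiseDisjoint Sh := fun i _ j _ hij =>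
    disjoint_shellPairs_of_ne hij
  have hLm : ∀ i ∈ Finset.range K, MeasurableSet (L i) := by
    intro i _
    refine measurableSet_of_isLocalEvent_holds ⟨(box d ((2 * m + 1) * (i + 1) + m)).sym2, ?_⟩
    refine (determinedBy_preimage_inter_edgeSet_of (determinedBy_sphereArm _ _)).mono fun e he => ?_
    exact Finset.mem_coe.2 (Finset.mem_sym2_iff.2 fun v hv => mem_box_iff_siteRad_le.2 (he v hv).2)
  -- each sphere arm fails with probability at least `1/2`
  have hLhalf : ∀ i ∈ Finset.range K, (rcLimit d b s q).real (L i) ≤ 1 / 2 := by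
    intro i hi
    have hlt := sphere_radius_lt hK (Finset.mem_range.1 hi)
    rw [hL, hreal hsI]
    refine (hPs.real_sphereArm_le hsI hq _ m).trans ?_
    have hA_m := hdecay m hm1
    have h2a : (2 * (((2 * m + 1) * (i + 1) : ℕ) : ℝ) + 1) ^ (d - 1) ≤ (2 * (n : ℝ) + 1) ^ (d - 1) := by
      refine pow_le_pow_left₀ (by positivity) ?_ _
      have : (((2 * m + 1) * (i + 1) : ℕ) : ℝ) ≤ n := by exact_mod_cast (by omega : (2 * m + 1) * (i + 1) ≤ n)
      linarith
    have hmα : (m : ℝ) ^ (-α) ≤ ((n : ℝ) ^ β) ^ (-α) :=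
      Real.rpow_le_rpow_of_nonpos (by positivity) hmlow (by linarith)
    calc 2 * (d : ℝ) * (2 * (((2 * m + 1) * (i + 1) : ℕ) : ℝ) + 1) ^ (d - 1) *
          (rcLimit d b s q).real (siteToBoundary d m)
        ≤ 2 * (d : ℝ) * (2 * (n : ℝ) + 1) ^ (d - 1) * (c₂ * ((n : ℝ) ^ β) ^ (-α)) := by
          gcongr
          exact hA_m.trans (mul_le_mul_of_nonneg_left hmα hc₂.le)
      _ ≤ 1 / 2 := h1n
  -- the mean Hamming distance is at least `K/2`
  have hH : (K : ℝ) / 2 ≤ ∑ k ∈ Finset.range (edgesIn (zdGraph d) (box d n)).card,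
      (1 - (rcLimit d b s q).real (withinDist (edgesIn (zdGraph d) (box d n)) A k)) := by
    have hJ := sum_sub_real_le_sum_sub_real_withinDist (μ := rcLimit d b s q) hAU hAF hAne (Finset.range K)
      hAL hLE hdisj hLm
    simp only [probReal_univ] at hJ
    refine le_trans ?_ hJ
    calc (K : ℝ) / 2 = ∑ i ∈ Finset.range K, (1 / 2 : ℝ) := by
          rw [Finset.sum_const, Finset.card_range, nsmul_eq_mul]; ring
      _ ≤ ∑ i ∈ Finset.range K, (1 - (rcLimit d b s q).real (L i)) :=
          Finset.sum_le_sum fun i hi => by linarith [hLhalf i hi]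
  -- (5.68) and the conclusion
  have h68 := IsBoxLimit.real_le_mul_exp hq hFE hAU hAF hAne hPr hPs hr hrs.le hs
  rw [hA, hreal hrI, hreal hsI] at h68
  have hθ1 : (rcLimit d b s q).real (siteToBoundary d n) ≤ 1 := measureReal_le_one
  have hsr : 0 < s - r := by linarith
  calc (rcLimit d b r q).real (siteToBoundary d n)
      ≤ (rcLimit d b s q).real (siteToBoundary d n) * Real.exp (-4 * (s - r) *
          ∑ k ∈ Finset.range (edgesIn (zdGraph d) (box d n)).card,
            (1 - (rcLimit d b s q).real (withinDist (edgesIn (zdGraph d) (box d n)) A k))) := h68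
    _ ≤ 1 * Real.exp (-4 * (s - r) * ((K : ℝ) / 2)) := by
        refine mul_le_mul hθ1 (Real.exp_le_exp.2 ?_) (Real.exp_pos _).le zero_le_one
        nlinarith [hH]
    _ ≤ Real.exp (-((s - r) / 10) * (n : ℝ) ^ (1 - β)) := by
        rw [one_mul, Real.exp_le_exp]
        nlinarith [hKge]

/-- **Lemma (5.71) of Grimmett 2006 in hypothesis form** (the first stage of Thm. (5.60), "if `φ(0 ↔ ∂Λ_n)` decays at
the polynomial rate `n^{1-d}` then it decays faster than any power"): for `d ≥ 2`, `q ≥ 1`, either `b`, `0 < r < t < 1`: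
if `φ^b_{t,q}(0 ↔ ∂Λ_n) ≤ c₁ n^{-(d-1)}` for all `n ≥ 1` (`c₁ > 0`; i.e. `L(t,q) < ∞` in the notation (5.57)), then there
are `c > 0`, `Δ ∈ (0,1)` and `N` with `φ^b_{r,q}(0 ↔ ∂Λ_n) ≤ exp(-c n^Δ)` for all `n ≥ N` ((5.74) at `s = (r+t)/2`
by `SteepnessAmplification.lean`, then the annulus iteration).
[cite: Grimmett2006, Lemma (5.71) pp. 115–116] -/
theorem rcLimit_real_siteToBoundary_le_exp_neg_rpow_of_polynomial_decay (hd : 2 ≤ d) (b : Bool) {q : ℝ}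
    (hq : 1 ≤ q) {r t : ℝ} (hr : 0 < r) (hrt : r < t) (ht : t < 1) {c₁ : ℝ} (hc₁ : 0 < c₁)
    (hdecay : ∀ n : ℕ, 1 ≤ n → (rcLimit d b t q).real (siteToBoundary d n) ≤ c₁ * (n : ℝ) ^ (-((d : ℝ) - 1))) :
    ∃ c : ℝ, 0 < c ∧ ∃ Δ : ℝ, Δ ∈ Set.Ioo (0 : ℝ) 1 ∧ ∃ N : ℕ, ∀ n : ℕ, N ≤ n →
      (rcLimit d b r q).real (siteToBoundary d n) ≤ Real.exp (-c * (n : ℝ) ^ Δ) := by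
  -- intermediate density `s = (r+t)/2`; (5.74) at `s` from the hypothesis at `t`
  set s : ℝ := (r + t) / 2 with hs
  have hrs : r < s := by rw [hs]; linarith
  have hst : s < t := by rw [hs]; linarith
  have hs0 : 0 < s := hr.trans hrs
  set s' : ℝ := (s + t) / 2 with hs'
  set C : ℝ := (q * (q * (1 - s'))) / ((t - s') * (s' + q * (1 - s'))) with hC
  have hss' : s < s' := by rw [hs']; linarith
  have hs't : s' < t := by rw [hs']; linarith
  have hC1 : 1 < C := one_lt_sprinklingConst hq (hs0.trans hss') hs't ht
  set δ : ℝ := 4 * (s' - s) / Real.log C with hδ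
  have hδ0 : 0 < δ := div_pos (by linarith) (Real.log_pos hC1)
  set c₂ : ℝ := Real.exp (4 * (s' - s) * (C / (C - 1))) * c₁ ^ (1 + δ) with hc₂
  have hc₂0 : 0 < c₂ := mul_pos (Real.exp_pos _) (Real.rpow_pos_of_pos hc₁ _)
  have k₀ : Fin d := ⟨0, by omega⟩
  have h74 : ∀ m : ℕ, 1 ≤ m → (rcLimit d b s q).real (siteToBoundary d m) ≤
      c₂ * (m : ℝ) ^ (-(((d : ℝ) - 1) * (1 + δ))) := by
    intro m hm
    have h := rcLimit_real_siteToBoundary_le_of_polynomial_decay b hq k₀ hs0 hst ht hc₁ hdecay m hm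
    -- the amplification file's `s` is `(s+t)/2 = s'`; unfold the abbreviations
    simpa only [hc₂, hδ, hC, hs', mul_assoc] using h
  -- the exponent `(d-1)(1+δ) > d-1` (here `d ≥ 2` is used)
  have hd2 : 2 ≤ d := hd
  have hα : (d : ℝ) - 1 < ((d : ℝ) - 1) * (1 + δ) := by
    have : (1 : ℝ) ≤ (d : ℝ) - 1 := by
      have : (2 : ℝ) ≤ d := by exact_mod_cast hd2
      linarith
    nlinarith
  obtain ⟨N, hN⟩ := rcLimit_real_siteToBoundary_le_exp_neg_rpow (by omega) b hq hr hrs (hst.trans ht) hc₂0 hα h74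
  set β : ℝ := (((d : ℝ) - 1) / (((d : ℝ) - 1) * (1 + δ)) + 1) / 2 with hβ
  have hquot : ((d : ℝ) - 1) / (((d : ℝ) - 1) * (1 + δ)) = 1 / (1 + δ) := by
    have : (d : ℝ) - 1 ≠ 0 := by
      have : (2 : ℝ) ≤ d := by exact_mod_cast hd2
      linarith
    field_simp
  have hβlt : β < 1 := by
    rw [hβ, hquot]
    have : 1 / (1 + δ) < 1 := (div_lt_one (by linarith)).2 (by linarith)
    linarith
  have hβpos : 0 < β := by rw [hβ, hquot]; positivity
  exact ⟨(s - r) / 10, by linarith, 1 - β, ⟨by linarith, by linarith⟩, N, fun n hn => hN n hn⟩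

end FK

end Summit.CriticalPhenomena.PercolationContinuityZ3.Theorems

end
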